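import Literature.NumberTheory.EllipticCurves.ThetaDatumTwist
import Literature.NumberTheory.EllipticCurves.WeilPairingLevelDescent
import Literature.NumberTheory.EllipticCurves.TwoPowerTorsion
import Literature.NumberTheory.EllipticCurves.PointDivisibilityProofs
import Literature.GroupTheory.FiniteAbelian.KleinFourQuadraticRefinement
import HarnessLib

/-!
# The `μ_{m²}`-valued theta group of an elliptic curve on `E[2m²]` at EVEN `m`, with its level structure
# (Morgan–Smith Def. 5.19 normalised by the Arf-invariant-`1` form on `E[2]`)

Topic `NumberTheory/EllipticCurves`; namespace `Literature.NumberTheory.EllipticCurves`.  Definitions with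
bodies and theorems: **no named fact is introduced** (D-0026).

Input: an elliptic curve `E/K` (model `W`, `char K = 0`), an EVEN `m`, and an alternating multiplicatively
bi-additive `Γ_K`-equivariant pairing `P : E[2m²] × E[2m²] → K̄` with `P^{2m²} = 1` (in the application, a
unit power of the Weil pairing `e_{2m²}`, so that `P(x, y)² = e_{m²}(2x, 2y)` for the pairing `e_{m²}` of the
Cassels–Tate construction).  Output (`n = m²`):

* `etaFn` — the normalisation `η : E[2m²] → K̄ˣ`, `η_x = η₀` (a fixed `η₀` with `η₀ⁿ = −1`) if the pairing
  `B = Pⁿ` (which factors through `[n] : E[2m²] → E[2]`, `pow_pair_eq_arfPairing`) is non-trivial and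
  `n x ≠ 0`, `η_x = 1` otherwise: `η_xⁿ = arfSign_B(n x)` (`Literature.GroupTheory.FiniteAbelian.arfSign`), so
  that `(η_x η_y η_{x+y}⁻¹ P(x,y))ⁿ = 1` (`twist_pow_eq_one`, the quadratic refinement identity
  `mul_arfSign_mul_arfSign` on the Klein four-group `E[2]`) and `(σ η_x / η_x)ⁿ = 1`;
* `thetaEven` — the resulting Heisenberg datum `twistMu` of `Γ_K` on `E[2m²]` with values in `μₙ`
  (Morgan–Smith's `𝓗(M[λ])` for `M = E`, `λ = [m²]`, cut down to `μₙ`), `thetaEven_commForm` (its commutator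
  form is `P(x,y)/P(y,x) = P(x,y)²`), `continuous_thetaEven_χ`;
* `levelEven` — a LEVEL STRUCTURE (`HeisenbergDatum.LevelStructure`) on `thetaEven` over
  `E[2m] = {x : [m][2] x = 0}`: `λ(x̃) = arfSign_{P|}(m x̃)` (the same Arf normalisation one level down, for the
  `±1`-valued pairing `P|_{E[2m]}`, which factors through `[m] : E[2m] → E[2]`), an equivariant homomorphic
  section over `E[2m]` — this uses `2 ∣ m` (`n·E[2m] = 0`).

With the local isotropy of the sequel this is the `LevelThetaDatum` of `CasselsTateSelfPairingLevel` at
`l = 2`, whence Cassels' alternation `⟨a, a⟩ = 0` of the tree's Cassels–Tate pairing at even level.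
References: [MorganSmith2021CTP] §5.3 Def. 5.19, §5.4 Prop. 5.24 (Mumford's `e_*^L`); D. Mumford, *On the
equations defining abelian varieties I* (1966) §2; [PoonenRains2012] §4.1; [SilvermanAEC2009] III.6.4, III.8.1.
-/

noncomputable section

open scoped Classical

universe u

namespace Literature.NumberTheory.EllipticCurves

open _root_.WeierstrassCurve Field Function
open Literature.NumberTheory.GaloisRepresentations
open Literature.NumberTheory.GaloisRepresentations.DiscreteGaloisModule (mu MuCarrier)
open Literature.Algebra.Homology Literature.GroupTheory.FiniteAbelian

variable {K : Type u} [Field K] [CharZero K] (W : WeierstrassCurve K) [W.IsElliptic] (m : ℕ) [NeZero m]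

/-! ### Multiplicative bi-additivity: powers and vanishing -/

section PairingAlgebra

variable {N : ℕ} (P : geomTorsion W (N : ℤ) → geomTorsion W (N : ℤ) → AlgebraicClosure K)
  (hP0 : ∀ x y, P x y ≠ 0)
  (hPadd₁ : ∀ x₁ x₂ y, P (x₁ + x₂) y = P x₁ y * P x₂ y)
  (hPadd₂ : ∀ x y₁ y₂, P x (y₁ + y₂) = P x y₁ * P x y₂)

omit [CharZero K] [W.IsElliptic] [NeZero m] in
include hP0 hPadd₁ in
/-- `P(k·x, y) = P(x, y)ᵏ`. [cite: MorganSmith2021CTP, §5.3 Def. 5.19 (bi-additivity of P₁)] -/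
theorem pair_nsmul_left (k : ℕ) (x y : geomTorsion W (N : ℤ)) : P (k • x) y = P x y ^ k := by
  induction k with
  | zero => rw [zero_smul, pow_zero, pair_zero_left W N P hP0 hPadd₁]
  | succ k ih => rw [add_smul, one_smul, hPadd₁, ih, pow_succ]

omit [CharZero K] [W.IsElliptic] [NeZero m] in
include hP0 hPadd₂ in
/-- `P(x, k·y) = P(x, y)ᵏ`. [cite: MorganSmith2021CTP, §5.3 Def. 5.19 (bi-additivity of P₁)] -/
theorem pair_nsmul_right (k : ℕ) (x y : geomTorsion W (N : ℤ)) : P x (k • y) = P x y ^ k := by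
  induction k with
  | zero => rw [zero_smul, pow_zero, pair_zero_right W N P hP0 hPadd₂]
  | succ k ih => rw [add_smul, one_smul, hPadd₂, ih, pow_succ]

omit [CharZero K] [W.IsElliptic] [NeZero m] in
include hPadd₁ hPadd₂ in
/-- An alternating bi-additive pairing is antisymmetric: `P(x, y) · P(y, x) = 1`. [cite: MorganSmith2021CTP, §5.3 Def. 5.19 (P₁ antisymmetric)] -/
theorem pair_mul_pair_swap (hPalt : ∀ x, P x x = 1) (x y : geomTorsion W (N : ℤ)) : P x y * P y x = 1 := by
  have h := hPalt (x + y)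
  rw [hPadd₁, hPadd₂, hPadd₂, hPalt, hPalt, one_mul, mul_one] at h
  exact h

end PairingAlgebra

/-! ### The projections `[n] : E[2m²] → E[2]` and lifts -/

section Even

variable (P : geomTorsion W ((2 * (m * m) : ℕ) : ℤ) → geomTorsion W ((2 * (m * m) : ℕ) : ℤ) → AlgebraicClosure K)
  (hP1 : ∀ x y, P x y ^ (2 * (m * m)) = 1)
  (hPadd₁ : ∀ x₁ x₂ y, P (x₁ + x₂) y = P x₁ y * P x₂ y)
  (hPadd₂ : ∀ x y₁ y₂, P x (y₁ + y₂) = P x y₁ * P x y₂)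
  (hPalt : ∀ x, P x x = 1)
  (hPgal : ∀ (σ : absoluteGaloisGroup K) (x y : geomTorsion W ((2 * (m * m) : ℕ) : ℤ)),
    σ • P x y = P (σ • x) (σ • y))

omit [CharZero K] [W.IsElliptic] in
include hP1 in
/-- `P` does not vanish. [cite: MorganSmith2021CTP, §5.3 Def. 5.19 (values of P₁ in K̄ˣ)] -/
theorem pair_ne_zero (x y : geomTorsion W ((2 * (m * m) : ℕ) : ℤ)) : P x y ≠ 0 := fun h => by
  have := hP1 x y
  rw [h, zero_pow (Nat.mul_ne_zero two_ne_zero (Nat.mul_ne_zero (NeZero.ne m) (NeZero.ne m)))] at this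
  exact zero_ne_one this

/-- **`[n] : E[2m²] → E[2]`**, `x ↦ m² x` (`n = m²`). [cite: SilvermanAEC2009, III.§7 (the torsion subgroups E[m])] -/
def projTwo (x : geomTorsion W ((2 * (m * m) : ℕ) : ℤ)) : geomTorsion W (2 : ℤ) :=
  ⟨((m * m : ℕ) : ℤ) • (x : geomPoints W), by
    rw [WeierstrassCurve.mem_geomTorsion_iff, smul_smul]
    have hx := (WeierstrassCurve.mem_geomTorsion_iff W _ _).mp x.2
    have h2 : (2 : ℤ) * ((m * m : ℕ) : ℤ) = ((2 * (m * m) : ℕ) : ℤ) := by push_cast; ring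
    rw [h2]
    exact hx⟩

omit [CharZero K] [W.IsElliptic] [NeZero m] in
/-- Underlying point of `projTwo x`. [cite: SilvermanAEC2009, III.§7 (the torsion subgroups E[m])] -/
@[simp] theorem coe_projTwo (x : geomTorsion W ((2 * (m * m) : ℕ) : ℤ)) :
    (projTwo W m x : geomPoints W) = ((m * m : ℕ) : ℤ) • (x : geomPoints W) := rfl

omit [CharZero K] [W.IsElliptic] [NeZero m] in
/-- `projTwo` is additive. [cite: SilvermanAEC2009, III.§7 (the torsion subgroups E[m])] -/
theorem projTwo_add (x y : geomTorsion W ((2 * (m * m) : ℕ) : ℤ)) :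
    projTwo W m (x + y) = projTwo W m x + projTwo W m y :=
  Subtype.ext (by simp only [coe_projTwo, AddSubgroup.coe_add, smul_add])

omit [CharZero K] [W.IsElliptic] [NeZero m] in
/-- `projTwo` is equivariant. [cite: SilvermanAEC2009, III.§7 (the torsion subgroups E[m])] -/
theorem projTwo_smul (σ : absoluteGaloisGroup K) (x : geomTorsion W ((2 * (m * m) : ℕ) : ℤ)) :
    projTwo W m (σ • x) = σ • projTwo W m x :=
  Subtype.ext (by
    simp only [coe_projTwo, AddSubgroup.torsionBy.coe_smul]
    exact (smul_zsmul_geomPoints W _ σ (x : geomPoints W)).symm)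

omit [CharZero K] [W.IsElliptic] [NeZero m] in
/-- `projTwo x` as a multiple inside `E[2m²]`: `(projTwo x : E) = ((m²) • x : E[2m²])`. [cite: SilvermanAEC2009, III.§7 (the torsion subgroups E[m])] -/
theorem coe_projTwo_eq_coe_nsmul (x : geomTorsion W ((2 * (m * m) : ℕ) : ℤ)) :
    (projTwo W m x : geomPoints W) = (((m * m) • x : geomTorsion W ((2 * (m * m) : ℕ) : ℤ)) : geomPoints W) := by
  rw [coe_projTwo, AddSubgroupClass.coe_nsmul, natCast_zsmul]

omit [CharZero K] in
/-- **`[n] : E[2m²] → E[2]` is onto** (divisibility of `E(K̄)`). [cite: SilvermanAEC2009, Cor. III.6.4 ([m] is surjective on E(K̄))] -/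
theorem exists_projTwo_eq (t : geomTorsion W (2 : ℤ)) : ∃ x : geomTorsion W ((2 * (m * m) : ℕ) : ℤ), projTwo W m x = t := by
  have hn : ((m * m : ℕ) : ℤ) ≠ 0 := Int.natCast_ne_zero.mpr (Nat.mul_ne_zero (NeZero.ne m) (NeZero.ne m))
  obtain ⟨Q, hQ⟩ := W.zsmul_geomPoints_surjective_holds hn (t : geomPoints W)
  have hQmem : Q ∈ geomTorsion W ((2 * (m * m) : ℕ) : ℤ) := by
    rw [WeierstrassCurve.mem_geomTorsion_iff]
    have h2 : ((2 * (m * m) : ℕ) : ℤ) = (2 : ℤ) * ((m * m : ℕ) : ℤ) := by push_cast; ring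
    have ht := (WeierstrassCurve.mem_geomTorsion_iff W _ _).mp t.2
    rw [h2, mul_smul]
    change (2 : ℤ) • ((fun Q : geomPoints W => ((m * m : ℕ) : ℤ) • Q) Q) = 0
    rw [hQ]
    exact ht
  exact ⟨⟨Q, hQmem⟩, Subtype.ext hQ⟩

/-- A lift of `t ∈ E[2]` along `[n]`. [cite: SilvermanAEC2009, Cor. III.6.4 ([m] is surjective on E(K̄))] -/
def liftTwo (t : geomTorsion W (2 : ℤ)) : geomTorsion W ((2 * (m * m) : ℕ) : ℤ) := (exists_projTwo_eq W m t).choose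

omit [CharZero K] in
/-- `[n] (liftTwo t) = t`. [cite: SilvermanAEC2009, Cor. III.6.4 ([m] is surjective on E(K̄))] -/
@[simp] theorem projTwo_liftTwo (t : geomTorsion W (2 : ℤ)) : projTwo W m (liftTwo W m t) = t :=
  (exists_projTwo_eq W m t).choose_spec

/-! ### The pairing `B = Pⁿ` factors through `E[2]` -/

omit [CharZero K] [W.IsElliptic] in
include hP1 hPadd₁ in
/-- `P(x, y)ⁿ` only depends on `[n] x`. [cite: MorganSmith2021CTP, §5.3 Def. 5.19 (the pairing P₀(2m, 2n) = P₁(m, n)²)] -/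
theorem pow_pair_eq_of_projTwo_eq {x x' : geomTorsion W ((2 * (m * m) : ℕ) : ℤ)} (h : projTwo W m x = projTwo W m x')
    (y : geomTorsion W ((2 * (m * m) : ℕ) : ℤ)) : P x y ^ (m * m) = P x' y ^ (m * m) := by
  have hP0 := pair_ne_zero W m P hP1
  -- `x = x' + z` with `n z = 0`
  have hz : (m * m) • (x - x') = 0 := by
    apply Subtype.ext
    rw [← coe_projTwo_eq_coe_nsmul, ZeroMemClass.coe_zero]
    have := congrArg (fun t : geomTorsion W (2 : ℤ) => (t : geomPoints W)) h
    simp only [coe_projTwo, AddSubgroupClass.coe_sub, smul_sub] at this ⊢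
    rw [this, sub_self]
  have hx : x = x' + (x - x') := by abel
  rw [hx, hPadd₁, mul_pow, ← pair_nsmul_left W P hP0 hPadd₁ (m * m) (x - x') y, hz,
    pair_zero_left W _ P hP0 hPadd₁, mul_one]

omit [CharZero K] [W.IsElliptic] in
include hP1 hPadd₂ in
/-- `P(x, y)ⁿ` only depends on `[n] y`. [cite: MorganSmith2021CTP, §5.3 Def. 5.19 (the pairing P₀(2m, 2n) = P₁(m, n)²)] -/
theorem pow_pair_eq_of_projTwo_eq_right (x : geomTorsion W ((2 * (m * m) : ℕ) : ℤ)) {y y' : geomTorsion W ((2 * (m * m) : ℕ) : ℤ)}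
    (h : projTwo W m y = projTwo W m y') : P x y ^ (m * m) = P x y' ^ (m * m) := by
  have hP0 := pair_ne_zero W m P hP1
  have hz : (m * m) • (y - y') = 0 := by
    apply Subtype.ext
    rw [← coe_projTwo_eq_coe_nsmul, ZeroMemClass.coe_zero]
    have := congrArg (fun t : geomTorsion W (2 : ℤ) => (t : geomPoints W)) h
    simp only [coe_projTwo, AddSubgroupClass.coe_sub, smul_sub] at this ⊢
    rw [this, sub_self]
  have hy : y = y' + (y - y') := by abel
  rw [hy, hPadd₂, mul_pow, ← pair_nsmul_right W P hP0 hPadd₂ (m * m) x (y - y'), hz,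
    pair_zero_right W _ P hP0 hPadd₂, mul_one]

/-- **The pairing `B̄` on `E[2]`** induced by `B = Pⁿ`: `B̄(s, t) = P(s̃, t̃)ⁿ` for lifts `s̃, t̃` along `[n]`.
[cite: MorganSmith2021CTP, §5.3 Def. 5.19 (the pairing P₁ on M[2])] -/
def arfPairing (s t : geomTorsion W (2 : ℤ)) : AlgebraicClosure K := P (liftTwo W m s) (liftTwo W m t) ^ (m * m)

omit [CharZero K] in
include hP1 hPadd₁ hPadd₂ in
/-- `P(x, y)ⁿ = B̄([n] x, [n] y)`. [cite: MorganSmith2021CTP, §5.3 Def. 5.19 (the pairing P₁ on M[2])] -/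
theorem pow_pair_eq_arfPairing (x y : geomTorsion W ((2 * (m * m) : ℕ) : ℤ)) :
    P x y ^ (m * m) = arfPairing W m P (projTwo W m x) (projTwo W m y) := by
  rw [arfPairing, pow_pair_eq_of_projTwo_eq W m P hP1 hPadd₁ (x' := liftTwo W m (projTwo W m x))
      (by rw [projTwo_liftTwo]) y,
    pow_pair_eq_of_projTwo_eq_right W m P hP1 hPadd₂ _ (y' := liftTwo W m (projTwo W m y)) (by rw [projTwo_liftTwo])]

omit [CharZero K] in
include hPalt in
/-- `B̄` is alternating. [cite: MorganSmith2021CTP, §5.3 Def. 5.19 (the pairing P₁ on M[2])] -/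
theorem arfPairing_self (t : geomTorsion W (2 : ℤ)) : arfPairing W m P t t = 1 := by
  rw [arfPairing, hPalt, one_pow]

omit [CharZero K] in
include hP1 hPadd₁ hPadd₂ in
/-- `B̄` is multiplicatively additive in the first variable. [cite: MorganSmith2021CTP, §5.3 Def. 5.19 (the pairing P₁ on M[2])] -/
theorem arfPairing_add_left (s s' t : geomTorsion W (2 : ℤ)) :
    arfPairing W m P (s + s') t = arfPairing W m P s t * arfPairing W m P s' t := by
  have h : projTwo W m (liftTwo W m s + liftTwo W m s') = s + s' := by rw [projTwo_add, projTwo_liftTwo, projTwo_liftTwo]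
  have := pow_pair_eq_arfPairing W m P hP1 hPadd₁ hPadd₂ (liftTwo W m s + liftTwo W m s') (liftTwo W m t)
  rw [h, projTwo_liftTwo] at this
  rw [← this, hPadd₁, mul_pow, pow_pair_eq_arfPairing W m P hP1 hPadd₁ hPadd₂,
    pow_pair_eq_arfPairing W m P hP1 hPadd₁ hPadd₂, projTwo_liftTwo, projTwo_liftTwo, projTwo_liftTwo]

omit [CharZero K] in
include hP1 hPadd₁ hPadd₂ in
/-- `B̄` is multiplicatively additive in the second variable. [cite: MorganSmith2021CTP, §5.3 Def. 5.19 (the pairing P₁ on M[2])] -/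
theorem arfPairing_add_right (s t t' : geomTorsion W (2 : ℤ)) :
    arfPairing W m P s (t + t') = arfPairing W m P s t * arfPairing W m P s t' := by
  have h : projTwo W m (liftTwo W m t + liftTwo W m t') = t + t' := by rw [projTwo_add, projTwo_liftTwo, projTwo_liftTwo]
  have := pow_pair_eq_arfPairing W m P hP1 hPadd₁ hPadd₂ (liftTwo W m s) (liftTwo W m t + liftTwo W m t')
  rw [h, projTwo_liftTwo] at this
  rw [← this, hPadd₂, mul_pow, pow_pair_eq_arfPairing W m P hP1 hPadd₁ hPadd₂,
    pow_pair_eq_arfPairing W m P hP1 hPadd₁ hPadd₂, projTwo_liftTwo, projTwo_liftTwo, projTwo_liftTwo]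

omit [CharZero K] in
include hP1 in
/-- `B̄ = ±1`. [cite: MorganSmith2021CTP, §5.3 Def. 5.19 (the pairing P₁ on M[2])] -/
theorem arfPairing_eq_one_or (s t : geomTorsion W (2 : ℤ)) : arfPairing W m P s t = 1 ∨ arfPairing W m P s t = -1 := by
  apply mul_self_eq_one_iff.mp
  rw [arfPairing, ← pow_two, ← pow_mul, mul_comm, hP1]

omit [CharZero K] in
include hP1 hPadd₁ hPadd₂ hPgal in
/-- `B̄` is equivariant: `B̄(σs, σt) = σ B̄(s, t)`. [cite: MorganSmith2021CTP, §5.3 Def. 5.19 (G_F-equivariance of P₁)] -/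
theorem arfPairing_smul (σ : absoluteGaloisGroup K) (s t : geomTorsion W (2 : ℤ)) :
    arfPairing W m P (σ • s) (σ • t) = σ • arfPairing W m P s t := by
  have := pow_pair_eq_arfPairing W m P hP1 hPadd₁ hPadd₂ (σ • liftTwo W m s) (σ • liftTwo W m t)
  rw [projTwo_smul, projTwo_smul, projTwo_liftTwo, projTwo_liftTwo] at this
  rw [← this, ← hPgal, ← smul_pow', arfPairing]

omit [CharZero K] [W.IsElliptic] [NeZero m] in
/-- `E[2]` has exponent `2`. [cite: SilvermanAEC2009, Cor. III.6.4(b) (E[2] ≅ (ℤ/2)²)] -/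
theorem two_torsion_add_self (t : geomTorsion W (2 : ℤ)) : t + t = 0 := by
  apply Subtype.ext
  have ht := (WeierstrassCurve.mem_geomTorsion_iff W _ _).mp t.2
  rw [AddSubgroup.coe_add, ZeroMemClass.coe_zero, ← two_smul ℤ, ht]

omit [NeZero m] in
/-- `#E[2] = 4`. [cite: SilvermanAEC2009, Cor. III.6.4(b) (E[2] ≅ (ℤ/2)²)] -/
theorem natCard_two_torsion : Nat.card (geomTorsion W (2 : ℤ)) = 4 := by
  have h := card_geomTorsion_two_pow W (two_ne_zero (α := K)) 1
  simpa using h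

/-! ### The normalisation `η` -/

omit [CharZero K] [W.IsElliptic] in
/-- A fixed `η₀ ∈ K̄ˣ` with `η₀ⁿ = −1` (`K̄` algebraically closed). [cite: MorganSmith2021CTP, §5.3 Def. 5.19 (square roots in K̄ˣ)] -/
theorem exists_unit_pow_eq_neg_one : ∃ η₀ : (AlgebraicClosure K)ˣ, (η₀ : AlgebraicClosure K) ^ (m * m) = -1 := by
  have hn : m * m ≠ 0 := Nat.mul_ne_zero (NeZero.ne m) (NeZero.ne m)
  obtain ⟨z, hz⟩ := IsAlgClosed.exists_pow_nat_eq (-1 : AlgebraicClosure K) (Nat.pos_of_ne_zero hn)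
  have hz0 : z ≠ 0 := fun h => by
    rw [h, zero_pow hn] at hz
    exact neg_ne_zero.mpr one_ne_zero hz.symm
  exact ⟨Units.mk0 z hz0, hz⟩

/-- The fixed `η₀` with `η₀ⁿ = −1`. [cite: MorganSmith2021CTP, §5.3 Def. 5.19 (square roots in K̄ˣ)] -/
def etaZero : (AlgebraicClosure K)ˣ := (exists_unit_pow_eq_neg_one (K := K) m).choose

omit [CharZero K] [W.IsElliptic] in
/-- `η₀ⁿ = −1`. [cite: MorganSmith2021CTP, §5.3 Def. 5.19 (square roots in K̄ˣ)] -/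
theorem etaZero_pow : ((etaZero (K := K) m : (AlgebraicClosure K)ˣ) : AlgebraicClosure K) ^ (m * m) = -1 :=
  (exists_unit_pow_eq_neg_one (K := K) m).choose_spec

/-- **The normalisation `η : E[2m²] → K̄ˣ`**: `η_x = η₀` if `B̄` is non-trivial and `[n] x ≠ 0`, else `1`, so that
`η_xⁿ = arfSign_{B̄}([n] x)`. [cite: MorganSmith2021CTP, §5.3 Def. 5.19 (the normalisation by e : M[2] → ±1)] -/
def etaFn (x : geomTorsion W ((2 * (m * m) : ℕ) : ℤ)) : (AlgebraicClosure K)ˣ :=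
  if (∃ s t, arfPairing W m P s t ≠ 1) ∧ projTwo W m x ≠ 0 then etaZero (K := K) m else 1

omit [CharZero K] in
/-- `η_xⁿ = arfSign([n] x)`. [cite: MorganSmith2021CTP, §5.3 Def. 5.19 (the normalisation by e : M[2] → ±1)] -/
theorem etaFn_pow (x : geomTorsion W ((2 * (m * m) : ℕ) : ℤ)) :
    ((etaFn W m P x : (AlgebraicClosure K)ˣ) : AlgebraicClosure K) ^ (m * m) = arfSign (arfPairing W m P) (projTwo W m x) := by
  unfold etaFn arfSign
  split_ifs with h
  · exact etaZero_pow m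
  · rw [Units.val_one, one_pow]

omit [CharZero K] in
/-- `η_0 = 1`. [cite: MorganSmith2021CTP, §5.3 Def. 5.19 (the normalisation by e : M[2] → ±1)] -/
theorem etaFn_zero : etaFn W m P 0 = 1 := by
  unfold etaFn
  rw [if_neg]
  rintro ⟨-, h⟩
  exact h (Subtype.ext (by rw [coe_projTwo, ZeroMemClass.coe_zero, smul_zero, ZeroMemClass.coe_zero]))

omit [CharZero K] in
/-- `η` is Galois invariant. [cite: MorganSmith2021CTP, §5.3 Def. 5.19 (G_F-stability of N)] -/
theorem etaFn_smul (σ : absoluteGaloisGroup K) (x : geomTorsion W ((2 * (m * m) : ℕ) : ℤ)) :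
    etaFn W m P (σ • x) = etaFn W m P x := by
  unfold etaFn
  have hiff : projTwo W m (σ • x) ≠ 0 ↔ projTwo W m x ≠ 0 := by
    rw [projTwo_smul, Ne, smul_eq_zero_iff_eq]
  by_cases h : (∃ s t, arfPairing W m P s t ≠ 1) ∧ projTwo W m x ≠ 0
  · rw [if_pos h, if_pos ⟨h.1, hiff.mpr h.2⟩]
  · rw [if_neg h, if_neg (fun h' => h ⟨h'.1, hiff.mp h'.2⟩)]

include hP1 hPadd₁ hPadd₂ hPalt in
/-- **The normalised cocycle values are `n`-th roots of unity**: `(η_x η_y η_{x+y}⁻¹ · P(x, y))ⁿ = 1` — the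
quadratic refinement identity `B̄(s,t) · arfSign s · arfSign t = arfSign (s + t)` on the Klein four-group `E[2]`.
[cite: MorganSmith2021CTP, §5.3 Def. 5.19 (N is a subgroup: e(x+y) e(x)⁻¹ e(y)⁻¹ = P₁(x, y))] -/
theorem twist_pow_eq_one (x y : geomTorsion W ((2 * (m * m) : ℕ) : ℤ)) :
    ((etaFn W m P x : AlgebraicClosure K) * etaFn W m P y / etaFn W m P (x + y) * P x y) ^ (m * m) = 1 := by
  have harf := mul_arfSign_mul_arfSign (arfPairing W m P) (arfPairing_self W m P hPalt)
    (arfPairing_add_left W m P hP1 hPadd₁ hPadd₂) (arfPairing_add_right W m P hP1 hPadd₁ hPadd₂)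
    (arfPairing_eq_one_or W m P hP1) (two_torsion_add_self W) (natCard_two_torsion W) (projTwo W m x) (projTwo W m y)
  have hsx := arfSign_ne_zero (arfPairing W m P) (projTwo W m x)
  have hsy := arfSign_ne_zero (arfPairing W m P) (projTwo W m y)
  have hc : arfPairing W m P (projTwo W m x) (projTwo W m y) ≠ 0 := by
    rcases arfPairing_eq_one_or W m P hP1 (projTwo W m x) (projTwo W m y) with h | h <;> rw [h]
    · exact one_ne_zero
    · exact neg_ne_zero.mpr one_ne_zero
  rw [mul_pow, div_pow, mul_pow, etaFn_pow, etaFn_pow, etaFn_pow, pow_pair_eq_arfPairing W m P hP1 hPadd₁ hPadd₂,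
    projTwo_add, ← harf, div_mul_eq_mul_div, div_eq_one_iff_eq (mul_ne_zero (mul_ne_zero hc hsx) hsy)]
  ring

/-- `(σ η_x / η_x)ⁿ = 1` (`η_xⁿ = ±1 ∈ K`). [cite: MorganSmith2021CTP, §5.3 Def. 5.19 (G_F-stability of N)] -/
theorem smul_etaFn_div_pow (σ : absoluteGaloisGroup K) (x : geomTorsion W ((2 * (m * m) : ℕ) : ℤ)) :
    (σ • (etaFn W m P x : AlgebraicClosure K) / etaFn W m P x) ^ (m * m) = 1 := by
  have hne := arfSign_ne_zero (arfPairing W m P) (projTwo W m x)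
  rw [div_pow, ← smul_pow', etaFn_pow]
  rcases arfSign_eq_one_or (arfPairing W m P) (projTwo W m x) with h | h
  · rw [h, smul_one, div_one]
  · rw [h, smul_neg, smul_one, div_self (neg_ne_zero.mpr one_ne_zero)]

/-! ### The theta group -/

/-- **The `μₙ`-valued theta group of `E` on `E[2m²]`** (`n = m²`): the Heisenberg datum `twistMu` of the pairing
`P` normalised by `η` — Morgan–Smith's `𝓗(E[m²])` (Def. 5.19 with `M = E`, `λ = [m²]`, `e = e_*`), cut down
to `μₙ` by the Arf-invariant-`1` form. [cite: MorganSmith2021CTP, §5.3 Def. 5.19 and §5.4 Prop. 5.24] -/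
def thetaEven : HeisenbergDatum (absoluteGaloisGroup K) (geomTorsion W ((2 * (m * m) : ℕ) : ℤ)) (MuCarrier K (m * m)) :=
  twistMu W (2 * (m * m)) P (pair_ne_zero W m P hP1) hPadd₁ hPadd₂ hPgal (etaFn W m P) (etaFn_zero W m P)
    (etaFn_smul W m P) (m * m) (twist_pow_eq_one W m P hP1 hPadd₁ hPadd₂ hPalt) (smul_etaFn_div_pow W m P)

/-- The module action of `thetaEven` is the Galois action. [cite: SilvermanAEC2009, III.§7 (the representation on E[m])] -/
@[simp] theorem thetaEven_ρ_apply (σ : absoluteGaloisGroup K) (x : geomTorsion W ((2 * (m * m) : ℕ) : ℤ)) :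
    (thetaEven W m P hP1 hPadd₁ hPadd₂ hPalt hPgal).ρ σ x = σ • x := rfl

/-- The value action of `thetaEven` is the Galois module `μₙ`. [cite: SerreGaloisCohomology1997, II §1.2 (μₙ as a Galois module)] -/
@[simp] theorem thetaEven_α_apply (σ : absoluteGaloisGroup K) (z : MuCarrier K (m * m)) :
    (thetaEven W m P hP1 hPadd₁ hPadd₂ hPalt hPgal).α σ z = mu K (m * m) σ z := rfl

/-- The correction terms of `thetaEven` are continuous. [cite: PoonenRains2012, §4.1 (Galois action on the Heisenberg group)] -/
theorem continuous_thetaEven_χ (x : geomTorsion W ((2 * (m * m) : ℕ) : ℤ)) :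
    Continuous fun σ : absoluteGaloisGroup K => (thetaEven W m P hP1 hPadd₁ hPadd₂ hPalt hPgal).χ σ x :=
  continuous_twistMu_χ W (2 * (m * m)) P (pair_ne_zero W m P hP1) hPadd₁ hPadd₂ hPgal (etaFn W m P) (etaFn_zero W m P)
    (etaFn_smul W m P) (m * m) (twist_pow_eq_one W m P hP1 hPadd₁ hPadd₂ hPalt) (smul_etaFn_div_pow W m P) x

/-- **The commutator form of `thetaEven` is `P(x, y)²`** (in `K̄`: `P(x,y)/P(y,x)` with `P` antisymmetric).
[cite: MorganSmith2021CTP, §5.3 Def. 5.19 (the commutator pairing P₀(2m,2n) = P₁(m,n)²)] -/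
theorem coe_thetaEven_commForm (x y : geomTorsion W ((2 * (m * m) : ℕ) : ℤ)) :
    (((Additive.toMul (MuCarrier.toAdditive ((thetaEven W m P hP1 hPadd₁ hPadd₂ hPalt hPgal).commForm x y))
        : rootsOfUnity (m * m) (AlgebraicClosure K)) : (AlgebraicClosure K)ˣ) : AlgebraicClosure K) = P x y ^ 2 := by
  rw [thetaEven, coe_twistMu_commForm]
  have h := pair_mul_pair_swap W P hPadd₁ hPadd₂ hPalt x y
  have h0 : P y x ≠ 0 := pair_ne_zero W m P hP1 y x
  rw [div_eq_iff h0]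
  linear_combination (-(P x y)) * h

/-! ### The level structure over `E[2m]` -/

/-- **The sub-object `E[2m] = {x ∈ E[2m²] : [m][2] x = 0}`** of the level structure. [cite: MorganSmith2021CTP, §5 Def. 5.7 (the sub-object M₁)] -/
def levelSub : AddSubgroup (geomTorsion W ((2 * (m * m) : ℕ) : ℤ)) where
  carrier := {x | mulK W m m (mulK W 2 (m * m) x) = 0}
  add_mem' {a b} ha hb := by
    simp only [Set.mem_setOf_eq, map_add] at ha hb ⊢
    rw [ha, hb, add_zero]
  zero_mem' := by simp only [Set.mem_setOf_eq, map_zero]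
  neg_mem' {a} ha := by
    simp only [Set.mem_setOf_eq, map_neg] at ha ⊢
    rw [ha, neg_zero]

omit [CharZero K] [W.IsElliptic] [NeZero m] in
/-- Membership in `levelSub`. [cite: MorganSmith2021CTP, §5 Def. 5.7 (the sub-object M₁)] -/
theorem mem_levelSub_iff (x : geomTorsion W ((2 * (m * m) : ℕ) : ℤ)) :
    x ∈ levelSub W m ↔ mulK W m m (mulK W 2 (m * m) x) = 0 := Iff.rfl

omit [CharZero K] [W.IsElliptic] [NeZero m] in
/-- Membership in `levelSub` on points: `x ∈ E[2m] ↔ (2m) x = 0`. [cite: MorganSmith2021CTP, §5 Def. 5.7 (the sub-object M₁)] -/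
theorem mem_levelSub_iff_zsmul (x : geomTorsion W ((2 * (m * m) : ℕ) : ℤ)) :
    x ∈ levelSub W m ↔ ((2 * m : ℕ) : ℤ) • (x : geomPoints W) = 0 := by
  rw [mem_levelSub_iff]
  constructor
  · intro h
    have := congrArg (fun t : geomTorsion W (m : ℤ) => (t : geomPoints W)) h
    simp only [coe_mulK_apply, ZeroMemClass.coe_zero, smul_smul] at this
    rw [← this]
    push_cast
    ring_nf
  · intro h
    apply Subtype.ext
    rw [coe_mulK_apply, coe_mulK_apply, ZeroMemClass.coe_zero, smul_smul, ← h]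
    push_cast
    ring_nf

omit [CharZero K] [W.IsElliptic] [NeZero m] in
/-- `levelSub` is Galois stable. [cite: MorganSmith2021CTP, §5 Def. 5.7 (the sub-object M₁)] -/
theorem smul_mem_levelSub (σ : absoluteGaloisGroup K) {x : geomTorsion W ((2 * (m * m) : ℕ) : ℤ)} (hx : x ∈ levelSub W m) :
    σ • x ∈ levelSub W m := by
  rw [mem_levelSub_iff] at hx ⊢
  rw [mulK_smul, mulK_smul, hx, smul_zero]

omit [CharZero K] [W.IsElliptic] [NeZero m] in
/-- For even `m`, `[n]` kills `E[2m]`: `projTwo x = 0` for `x ∈ levelSub` (`m² = (m/2)·(2m)`). [cite: MorganSmith2021CTP, §5.3 Def. 5.19 (the normalisation is trivial on M₁)] -/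
theorem projTwo_eq_zero_of_mem (hm : Even m) {x : geomTorsion W ((2 * (m * m) : ℕ) : ℤ)} (hx : x ∈ levelSub W m) :
    projTwo W m x = 0 := by
  obtain ⟨k, hk⟩ := hm
  rw [mem_levelSub_iff_zsmul] at hx
  apply Subtype.ext
  rw [coe_projTwo, ZeroMemClass.coe_zero]
  have h : ((m * m : ℕ) : ℤ) = (k : ℤ) * ((2 * m : ℕ) : ℤ) := by rw [hk]; push_cast; ring
  rw [h, mul_smul, hx, smul_zero]

omit [CharZero K] in
/-- `η_x = 1` on `E[2m]` (even `m`). [cite: MorganSmith2021CTP, §5.3 Def. 5.19 (the normalisation is trivial on M₁)] -/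
theorem etaFn_eq_one_of_mem (hm : Even m) {x : geomTorsion W ((2 * (m * m) : ℕ) : ℤ)} (hx : x ∈ levelSub W m) :
    etaFn W m P x = 1 := by
  unfold etaFn
  rw [if_neg]
  rintro ⟨-, h⟩
  exact h (projTwo_eq_zero_of_mem W m hm hx)

/-! #### `P` on `E[2m]` factors through `[m] : E[2m] → E[2]` -/

omit [CharZero K] in
include hP1 hPadd₁ hPadd₂ in
/-- `P(z, y) = 1` for `m z = 0` and `y ∈ E[2m]` (`z = (2m) w`, `P((2m)w, y) = P(w, (2m)y) = 1`). [cite: MorganSmith2021CTP, §5.3 Def. 5.19 (bi-additivity of P₁)] -/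
theorem pair_eq_one_of_zsmul_eq_zero {z y : geomTorsion W ((2 * (m * m) : ℕ) : ℤ)}
    (hz : (m : ℤ) • (z : geomPoints W) = 0) (hy : y ∈ levelSub W m) : P z y = 1 := by
  have hP0 := pair_ne_zero W m P hP1
  have h2m : ((2 * m : ℕ) : ℤ) ≠ 0 := Int.natCast_ne_zero.mpr (Nat.mul_ne_zero two_ne_zero (NeZero.ne m))
  obtain ⟨w, hw⟩ := W.zsmul_geomPoints_surjective_holds h2m (z : geomPoints W)
  have hwmem : w ∈ geomTorsion W ((2 * (m * m) : ℕ) : ℤ) := by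
    rw [WeierstrassCurve.mem_geomTorsion_iff]
    have h : ((2 * (m * m) : ℕ) : ℤ) = (m : ℤ) * ((2 * m : ℕ) : ℤ) := by push_cast; ring
    rw [h, mul_smul]
    change (m : ℤ) • ((fun Q : geomPoints W => ((2 * m : ℕ) : ℤ) • Q) w) = 0
    rw [hw]
    exact hz
  have hzw : z = (2 * m) • (⟨w, hwmem⟩ : geomTorsion W ((2 * (m * m) : ℕ) : ℤ)) := by
    apply Subtype.ext
    rw [AddSubgroupClass.coe_nsmul, ← natCast_zsmul]
    exact hw.symm
  have hy' : (2 * m) • y = 0 := by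
    apply Subtype.ext
    rw [AddSubgroupClass.coe_nsmul, ← natCast_zsmul, ZeroMemClass.coe_zero]
    exact (mem_levelSub_iff_zsmul W m y).mp hy
  rw [hzw, pair_nsmul_left W P hP0 hPadd₁, ← pair_nsmul_right W P hP0 hPadd₂, hy', pair_zero_right W _ P hP0 hPadd₂]

omit [CharZero K] in
include hP1 hPadd₁ hPadd₂ hPalt in
/-- `P(y, z) = 1` for `m z = 0` and `y ∈ E[2m]`. [cite: MorganSmith2021CTP, §5.3 Def. 5.19 (bi-additivity of P₁)] -/
theorem pair_eq_one_of_zsmul_eq_zero_right {y z : geomTorsion W ((2 * (m * m) : ℕ) : ℤ)}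
    (hy : y ∈ levelSub W m) (hz : (m : ℤ) • (z : geomPoints W) = 0) : P y z = 1 := by
  have h := pair_mul_pair_swap W P hPadd₁ hPadd₂ hPalt y z
  rw [pair_eq_one_of_zsmul_eq_zero W m P hP1 hPadd₁ hPadd₂ hz hy, mul_one] at h
  exact h

/-- The point `m x`. [cite: MorganSmith2021CTP, §5.3 Def. 5.19 (the map 2 : M[2λ] → M[λ])] -/
def projM (x : geomTorsion W ((2 * (m * m) : ℕ) : ℤ)) : geomPoints W := (m : ℤ) • (x : geomPoints W)

omit [CharZero K] [W.IsElliptic] [NeZero m] in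
/-- For `x ∈ E[2m]`, `m x ∈ E[2]`. [cite: SilvermanAEC2009, III.§7 (the torsion subgroups E[m])] -/
theorem projM_mem {x : geomTorsion W ((2 * (m * m) : ℕ) : ℤ)} (hx : x ∈ levelSub W m) : projM W m x ∈ geomTorsion W (2 : ℤ) := by
  rw [WeierstrassCurve.mem_geomTorsion_iff, projM, smul_smul]
  have h : (2 : ℤ) * (m : ℤ) = ((2 * m : ℕ) : ℤ) := by push_cast; ring
  rw [h]
  exact (mem_levelSub_iff_zsmul W m x).mp hx

/-- `[m] : E[2m] → E[2]` as a map on members. [cite: SilvermanAEC2009, III.§7 (the torsion subgroups E[m])] -/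
def pmOf (x : geomTorsion W ((2 * (m * m) : ℕ) : ℤ)) (hx : x ∈ levelSub W m) : geomTorsion W (2 : ℤ) :=
  ⟨projM W m x, projM_mem W m hx⟩

omit [CharZero K] [W.IsElliptic] [NeZero m] in
/-- Underlying point of `pmOf`. [cite: SilvermanAEC2009, III.§7 (the torsion subgroups E[m])] -/
@[simp] theorem coe_pmOf (x : geomTorsion W ((2 * (m * m) : ℕ) : ℤ)) (hx : x ∈ levelSub W m) :
    (pmOf W m x hx : geomPoints W) = (m : ℤ) • (x : geomPoints W) := rfl

omit [CharZero K] in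
/-- `[m] : E[2m] → E[2]` is onto. [cite: SilvermanAEC2009, Cor. III.6.4 ([m] is surjective on E(K̄))] -/
theorem exists_pmOf_eq (t : geomTorsion W (2 : ℤ)) :
    ∃ (x : geomTorsion W ((2 * (m * m) : ℕ) : ℤ)) (hx : x ∈ levelSub W m), pmOf W m x hx = t := by
  have hmz : (m : ℤ) ≠ 0 := Int.natCast_ne_zero.mpr (NeZero.ne m)
  obtain ⟨Q, hQ⟩ := W.zsmul_geomPoints_surjective_holds hmz (t : geomPoints W)
  have ht := (WeierstrassCurve.mem_geomTorsion_iff W _ _).mp t.2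
  have hQ' : (m : ℤ) • Q = (t : geomPoints W) := hQ
  have h2mQ : ((2 * m : ℕ) : ℤ) • Q = 0 := by
    have h : ((2 * m : ℕ) : ℤ) = (2 : ℤ) * (m : ℤ) := by push_cast; ring
    rw [h, mul_smul, hQ', ht]
  have hQmem : Q ∈ geomTorsion W ((2 * (m * m) : ℕ) : ℤ) := by
    rw [WeierstrassCurve.mem_geomTorsion_iff]
    have h : ((2 * (m * m) : ℕ) : ℤ) = (m : ℤ) * ((2 * m : ℕ) : ℤ) := by push_cast; ring
    rw [h, mul_smul, h2mQ, smul_zero]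
  refine ⟨⟨Q, hQmem⟩, (mem_levelSub_iff_zsmul W m _).mpr h2mQ, Subtype.ext hQ'⟩

/-- A lift of `t ∈ E[2]` to `E[2m]` along `[m]`. [cite: SilvermanAEC2009, Cor. III.6.4 ([m] is surjective on E(K̄))] -/
def liftM (t : geomTorsion W (2 : ℤ)) : geomTorsion W ((2 * (m * m) : ℕ) : ℤ) := (exists_pmOf_eq W m t).choose

omit [CharZero K] in
/-- `liftM t ∈ E[2m]`. [cite: SilvermanAEC2009, Cor. III.6.4 ([m] is surjective on E(K̄))] -/
theorem liftM_mem (t : geomTorsion W (2 : ℤ)) : liftM W m t ∈ levelSub W m := (exists_pmOf_eq W m t).choose_spec.choose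

omit [CharZero K] in
/-- `[m] (liftM t) = t`. [cite: SilvermanAEC2009, Cor. III.6.4 ([m] is surjective on E(K̄))] -/
@[simp] theorem pmOf_liftM (t : geomTorsion W (2 : ℤ)) : pmOf W m (liftM W m t) (liftM_mem W m t) = t :=
  (exists_pmOf_eq W m t).choose_spec.choose_spec

omit [CharZero K] in
include hP1 hPadd₁ hPadd₂ hPalt in
/-- On `E[2m]`, `P(x, y)` only depends on `m x` and `m y`. [cite: MorganSmith2021CTP, §5.3 Def. 5.19 (bi-additivity of P₁)] -/
theorem pair_eq_of_pmOf_eq {x x' y y' : geomTorsion W ((2 * (m * m) : ℕ) : ℤ)} (hx : x ∈ levelSub W m)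
    (hx' : x' ∈ levelSub W m) (hy : y ∈ levelSub W m) (hy' : y' ∈ levelSub W m)
    (h₁ : pmOf W m x hx = pmOf W m x' hx') (h₂ : pmOf W m y hy = pmOf W m y' hy') : P x y = P x' y' := by
  have hz₁ : (m : ℤ) • ((x - x' : geomTorsion W ((2 * (m * m) : ℕ) : ℤ)) : geomPoints W) = 0 := by
    have := congrArg (fun t : geomTorsion W (2 : ℤ) => (t : geomPoints W)) h₁
    simp only [coe_pmOf] at this
    rw [AddSubgroupClass.coe_sub, smul_sub, this, sub_self]
  have hz₂ : (m : ℤ) • ((y - y' : geomTorsion W ((2 * (m * m) : ℕ) : ℤ)) : geomPoints W) = 0 := by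
    have := congrArg (fun t : geomTorsion W (2 : ℤ) => (t : geomPoints W)) h₂
    simp only [coe_pmOf] at this
    rw [AddSubgroupClass.coe_sub, smul_sub, this, sub_self]
  have ex : x = x' + (x - x') := by abel
  have ey : y = y' + (y - y') := by abel
  rw [ex, hPadd₁, pair_eq_one_of_zsmul_eq_zero W m P hP1 hPadd₁ hPadd₂ hz₁ hy, mul_one, ey, hPadd₂,
    pair_eq_one_of_zsmul_eq_zero_right W m P hP1 hPadd₁ hPadd₂ hPalt hx' hz₂, mul_one]

/-- **The pairing on `E[2]` induced by `P|_{E[2m]}`**: `c₂(s, t) = P(s̃, t̃)` for lifts along `[m]`. [cite: MorganSmith2021CTP, §5.3 Def. 5.19 (the pairing P₁ on M[2])] -/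
def levelPairing (s t : geomTorsion W (2 : ℤ)) : AlgebraicClosure K := P (liftM W m s) (liftM W m t)

omit [CharZero K] in
include hP1 hPadd₁ hPadd₂ hPalt in
/-- `P(x, y) = c₂([m]x, [m]y)` on `E[2m]`. [cite: MorganSmith2021CTP, §5.3 Def. 5.19 (the pairing P₁ on M[2])] -/
theorem pair_eq_levelPairing {x y : geomTorsion W ((2 * (m * m) : ℕ) : ℤ)} (hx : x ∈ levelSub W m) (hy : y ∈ levelSub W m) :
    P x y = levelPairing W m P (pmOf W m x hx) (pmOf W m y hy) :=
  pair_eq_of_pmOf_eq W m P hP1 hPadd₁ hPadd₂ hPalt hx (liftM_mem W m _) hy (liftM_mem W m _)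
    (by rw [pmOf_liftM]) (by rw [pmOf_liftM])

omit [CharZero K] in
include hPalt in
/-- `c₂` is alternating. [cite: MorganSmith2021CTP, §5.3 Def. 5.19 (the pairing P₁ on M[2])] -/
theorem levelPairing_self (t : geomTorsion W (2 : ℤ)) : levelPairing W m P t t = 1 := hPalt _

omit [CharZero K] in
include hP1 hPadd₁ hPadd₂ hPalt in
/-- `c₂` is multiplicatively additive in the first variable. [cite: MorganSmith2021CTP, §5.3 Def. 5.19 (the pairing P₁ on M[2])] -/
theorem levelPairing_add_left (s s' t : geomTorsion W (2 : ℤ)) :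
    levelPairing W m P (s + s') t = levelPairing W m P s t * levelPairing W m P s' t := by
  have hmem : liftM W m s + liftM W m s' ∈ levelSub W m := (levelSub W m).add_mem (liftM_mem W m s) (liftM_mem W m s')
  have hpm : pmOf W m (liftM W m s + liftM W m s') hmem = s + s' := by
    apply Subtype.ext
    have h1 := congrArg (fun t : geomTorsion W (2 : ℤ) => (t : geomPoints W)) (pmOf_liftM W m s)
    have h2 := congrArg (fun t : geomTorsion W (2 : ℤ) => (t : geomPoints W)) (pmOf_liftM W m s')
    simp only [coe_pmOf] at h1 h2
    rw [coe_pmOf, AddSubgroup.coe_add, AddSubgroup.coe_add, smul_add, h1, h2]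
  have key := pair_eq_levelPairing W m P hP1 hPadd₁ hPadd₂ hPalt hmem (liftM_mem W m t)
  rw [hpm, pmOf_liftM, hPadd₁] at key
  rw [← key]
  rfl

omit [CharZero K] in
include hP1 hPadd₁ hPadd₂ hPalt in
/-- `c₂` is multiplicatively additive in the second variable. [cite: MorganSmith2021CTP, §5.3 Def. 5.19 (the pairing P₁ on M[2])] -/
theorem levelPairing_add_right (s t t' : geomTorsion W (2 : ℤ)) :
    levelPairing W m P s (t + t') = levelPairing W m P s t * levelPairing W m P s t' := by
  have hmem : liftM W m t + liftM W m t' ∈ levelSub W m := (levelSub W m).add_mem (liftM_mem W m t) (liftM_mem W m t')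
  have hpm : pmOf W m (liftM W m t + liftM W m t') hmem = t + t' := by
    apply Subtype.ext
    have h1 := congrArg (fun t : geomTorsion W (2 : ℤ) => (t : geomPoints W)) (pmOf_liftM W m t)
    have h2 := congrArg (fun t : geomTorsion W (2 : ℤ) => (t : geomPoints W)) (pmOf_liftM W m t')
    simp only [coe_pmOf] at h1 h2
    rw [coe_pmOf, AddSubgroup.coe_add, AddSubgroup.coe_add, smul_add, h1, h2]
  have key := pair_eq_levelPairing W m P hP1 hPadd₁ hPadd₂ hPalt (liftM_mem W m s) hmem
  rw [hpm, pmOf_liftM, hPadd₂] at key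
  rw [← key]
  rfl

omit [CharZero K] in
include hP1 hPadd₁ hPadd₂ in
/-- `c₂ = ±1` (`c₂(s,t)² = P(2s̃, t̃) = 1`). [cite: MorganSmith2021CTP, §5.3 Def. 5.19 (the pairing P₁ on M[2])] -/
theorem levelPairing_eq_one_or (s t : geomTorsion W (2 : ℤ)) : levelPairing W m P s t = 1 ∨ levelPairing W m P s t = -1 := by
  apply mul_self_eq_one_iff.mp
  rw [levelPairing, ← hPadd₁]
  have hz : (m : ℤ) • ((liftM W m s + liftM W m s : geomTorsion W ((2 * (m * m) : ℕ) : ℤ)) : geomPoints W) = 0 := by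
    have h1 := congrArg (fun t : geomTorsion W (2 : ℤ) => (t : geomPoints W)) (pmOf_liftM W m s)
    simp only [coe_pmOf] at h1
    rw [AddSubgroup.coe_add, smul_add, h1, ← AddSubgroup.coe_add, two_torsion_add_self, ZeroMemClass.coe_zero]
  exact pair_eq_one_of_zsmul_eq_zero W m P hP1 hPadd₁ hPadd₂ hz (liftM_mem W m t)

omit [CharZero K] in
include hP1 hPadd₁ hPadd₂ hPalt hPgal in
/-- `c₂` is equivariant. [cite: MorganSmith2021CTP, §5.3 Def. 5.19 (G_F-equivariance of P₁)] -/
theorem levelPairing_smul (σ : absoluteGaloisGroup K) (s t : geomTorsion W (2 : ℤ)) :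
    levelPairing W m P (σ • s) (σ • t) = σ • levelPairing W m P s t := by
  have hs : σ • liftM W m s ∈ levelSub W m := smul_mem_levelSub W m σ (liftM_mem W m s)
  have ht : σ • liftM W m t ∈ levelSub W m := smul_mem_levelSub W m σ (liftM_mem W m t)
  have h1 : pmOf W m (σ • liftM W m s) hs = σ • s := by
    apply Subtype.ext
    have h := congrArg (fun t : geomTorsion W (2 : ℤ) => (t : geomPoints W)) (pmOf_liftM W m s)
    simp only [coe_pmOf] at h
    rw [coe_pmOf, AddSubgroup.torsionBy.coe_smul, AddSubgroup.torsionBy.coe_smul, ← smul_zsmul_geomPoints, h]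
  have h2 : pmOf W m (σ • liftM W m t) ht = σ • t := by
    apply Subtype.ext
    have h := congrArg (fun t : geomTorsion W (2 : ℤ) => (t : geomPoints W)) (pmOf_liftM W m t)
    simp only [coe_pmOf] at h
    rw [coe_pmOf, AddSubgroup.torsionBy.coe_smul, AddSubgroup.torsionBy.coe_smul, ← smul_zsmul_geomPoints, h]
  have key := pair_eq_levelPairing W m P hP1 hPadd₁ hPadd₂ hPalt hs ht
  rw [h1, h2, ← hPgal] at key
  rw [← key]
  rfl

/-! #### The section `λ` and the level structure -/

/-- `−1 ∈ μₙ(K̄)` as an element of the carrier (even `n = m²`). [cite: SerreGaloisCohomology1997, II §1.2 (μₙ ⊂ K̄ˣ)] -/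
def negOneMu (hm : Even m) : MuCarrier K (m * m) :=
  MuCarrier.ofRootsOfUnity ⟨-1, by
    rw [mem_rootsOfUnity]
    exact (hm.mul_right m).neg_one_pow⟩

omit [CharZero K] [W.IsElliptic] [NeZero m] in
/-- Value of `negOneMu`. [cite: SerreGaloisCohomology1997, II §1.2 (μₙ ⊂ K̄ˣ)] -/
@[simp] theorem coe_negOneMu (hm : Even m) :
    (((Additive.toMul (MuCarrier.toAdditive (negOneMu (K := K) m hm)) : rootsOfUnity (m * m) (AlgebraicClosure K))
      : (AlgebraicClosure K)ˣ) : AlgebraicClosure K) = -1 := rfl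

/-- **The correction `λ` of the section over `E[2m]`**: `λ(x) = −1` if `c₂` is non-trivial and `m x ≠ 0`, else `1`
(`= arfSign_{c₂}([m] x)` on `E[2m]`). [cite: MorganSmith2021CTP, §5 Def. 5.7 (the homomorphic section s over M₁)] -/
def levelLam (hm : Even m) (x : geomTorsion W ((2 * (m * m) : ℕ) : ℤ)) : MuCarrier K (m * m) :=
  if (∃ s t, levelPairing W m P s t ≠ 1) ∧ projM W m x ≠ 0 then negOneMu m hm else 0

omit [CharZero K] in
/-- `λ(x) = arfSign_{c₂}([m] x)` in `K̄`, for `x ∈ E[2m]`. [cite: MorganSmith2021CTP, §5 Def. 5.7 (the homomorphic section s over M₁)] -/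
theorem coe_levelLam (hm : Even m) {x : geomTorsion W ((2 * (m * m) : ℕ) : ℤ)} (hx : x ∈ levelSub W m) :
    (((Additive.toMul (MuCarrier.toAdditive (levelLam W m P hm x)) : rootsOfUnity (m * m) (AlgebraicClosure K))
      : (AlgebraicClosure K)ˣ) : AlgebraicClosure K) = arfSign (levelPairing W m P) (pmOf W m x hx) := by
  have hiff : projM W m x ≠ 0 ↔ pmOf W m x hx ≠ 0 := by
    rw [Ne, Ne, ← Subtype.coe_inj, coe_pmOf, ZeroMemClass.coe_zero]
    rfl
  unfold levelLam arfSign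
  by_cases h : (∃ s t, levelPairing W m P s t ≠ 1) ∧ projM W m x ≠ 0
  · rw [if_pos h, if_pos ⟨h.1, hiff.mp h.2⟩, coe_negOneMu]
  · rw [if_neg h, if_neg (fun h' => h ⟨h'.1, hiff.mpr h'.2⟩)]
    rfl

omit [CharZero K] in
/-- `λ` is Galois invariant. [cite: MorganSmith2021CTP, §5 Def. 5.7 (equivariance of the section s)] -/
theorem levelLam_smul (hm : Even m) (σ : absoluteGaloisGroup K) (x : geomTorsion W ((2 * (m * m) : ℕ) : ℤ)) :
    levelLam W m P hm (σ • x) = levelLam W m P hm x := by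
  unfold levelLam
  have hiff : projM W m (σ • x) ≠ 0 ↔ projM W m x ≠ 0 := by
    rw [projM, projM, AddSubgroup.torsionBy.coe_smul, ← smul_zsmul_geomPoints, Ne, smul_eq_zero_iff_eq]
  by_cases h : (∃ s t, levelPairing W m P s t ≠ 1) ∧ projM W m x ≠ 0
  · rw [if_pos h, if_pos ⟨h.1, hiff.mpr h.2⟩]
  · rw [if_neg h, if_neg (fun h' => h ⟨h'.1, hiff.mp h'.2⟩)]

omit [CharZero K] in
/-- The Galois action on `μₙ` fixes `λ`-values `±1`: `σ · λ(x) = λ(x)`. [cite: SerreGaloisCohomology1997, II §1.2 (μₙ as a Galois module)] -/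
theorem mu_levelLam (hm : Even m) (σ : absoluteGaloisGroup K) (x : geomTorsion W ((2 * (m * m) : ℕ) : ℤ)) :
    mu K (m * m) σ (levelLam W m P hm x) = levelLam W m P hm x := by
  apply MuCarrier.toAdditive.injective
  rw [DiscreteGaloisModule.mu_apply_apply]
  apply Additive.toMul.injective
  rw [toMul_ofMul]
  apply Subtype.ext
  apply Units.ext
  rw [absoluteGaloisGroup.coe_smul_rootsOfUnity, Units.coe_smul]
  unfold levelLam
  split_ifs
  · rw [coe_negOneMu, smul_neg, smul_one]
  · exact smul_one σ

include hP1 hPadd₁ hPadd₂ hPalt in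
/-- **The level structure of `thetaEven` over `E[2m]`** (even `m`): `t(x̃) = (λ x̃, x̃)` is an equivariant
homomorphic section over `E[2m]` — the quadratic refinement identity for `c₂` on `E[2]`, and `η = 1` on `E[2m]`.
[cite: MorganSmith2021CTP, §5 Def. 5.7 and Thm. 5.10 (vanishing Poonen–Stoll class)] -/
def levelEven (hm : Even m) : (thetaEven W m P hP1 hPadd₁ hPadd₂ hPalt hPgal).LevelStructure where
  M₀ := levelSub W m
  smul_mem σ _ hx := smul_mem_levelSub W m σ hx
  lam := levelLam W m P hm
  m_add_lam {x y} hx hy := by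
    have hxy : x + y ∈ levelSub W m := (levelSub W m).add_mem hx hy
    apply MuCarrier.toAdditive.injective
    apply Additive.toMul.injective
    apply Subtype.ext
    apply Units.ext
    rw [map_add, toMul_add, map_add, toMul_add, Subgroup.coe_mul, Subgroup.coe_mul, Units.val_mul, Units.val_mul,
      thetaEven, coe_twistMu_m, coe_levelLam W m P hm hx, coe_levelLam W m P hm hy, coe_levelLam W m P hm hxy,
      etaFn_eq_one_of_mem W m P hm hx, etaFn_eq_one_of_mem W m P hm hy, etaFn_eq_one_of_mem W m P hm hxy,
      pair_eq_levelPairing W m P hP1 hPadd₁ hPadd₂ hPalt hx hy]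
    have hpm : pmOf W m (x + y) hxy = pmOf W m x hx + pmOf W m y hy :=
      Subtype.ext (by simp only [coe_pmOf, AddSubgroup.coe_add, smul_add])
    rw [hpm, Units.val_one, one_mul, div_one, one_mul]
    exact mul_arfSign_mul_arfSign (levelPairing W m P) (levelPairing_self W m P hPalt)
      (levelPairing_add_left W m P hP1 hPadd₁ hPadd₂ hPalt) (levelPairing_add_right W m P hP1 hPadd₁ hPadd₂ hPalt)
      (levelPairing_eq_one_or W m P hP1 hPadd₁ hPadd₂) (two_torsion_add_self W) (natCard_two_torsion W) _ _
  χ_add_lam σ {x} hx := by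
    rw [thetaEven_α_apply, mu_levelLam, thetaEven_ρ_apply, levelLam_smul]
    -- `χ_σ(x) = 0` since `η_x = 1`
    have hχ : (thetaEven W m P hP1 hPadd₁ hPadd₂ hPalt hPgal).χ σ x = 0 := by
      apply MuCarrier.toAdditive.injective
      apply Additive.toMul.injective
      apply Subtype.ext
      apply Units.ext
      rw [thetaEven, coe_twistMu_χ, etaFn_eq_one_of_mem W m P hm hx, Units.val_one, smul_one, div_one]
      rfl
    rw [hχ, zero_add]

end Even

end Literature.NumberTheory.EllipticCurves

end
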